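import Mathlib
import Summits.ValiantsHypothesis.ValiantsHypothesis.Theorems.ValuativeGCTValuativeFlipRayStability
import Literature.Computability.AlgebraicComplexity.PlethysmStability
import HarnessLib

/-!
# `ValuativeGCT.ValuativeFlip` (stmt-ValiantsHypothesis-12624): ray stability, III — the ambient
# plethysm coefficient `a_{μ♯(n+j)}(δ[n+j])`, monotone at EVERY step and eventually constant

Wall-breaker k16 (axis "representation-stability transfer between `m` and `m + 1`"), companion of
`…RayStability`.  Letters as there; in addition `a(j) := a_{μ♯(n+j)}(δ[n+j])`, the multiplicity of the
dual weight `(μ♯(n+j))*` in the AMBIENT coordinate ring `ℂ[Sym^{n+j} ℂ^{(n+j)²}]`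
(`plethysmCoeff ℂ (MatIdx (n+j)) (n+j) (partitionWeightLex (n+j) (rowLift μ j))`), the common majorant
of both sides of the flip (`orbitMultiplicity_le_plethysmCoeff`).

* `liftHWV_injective` — the Kadish–Landsberg/BIP lift `L = liftHWV m j` is injective (rename along the
  final segment, then BIP's inner lift, both injective).
* `plethysm_ray_mono` — **inner plethysm monotonicity at every step**: `a(j₁) ≤ a(j)` for ALL
  `j₁ ≤ j` (the lift is an injective linear map `HWV_{(μ♯(n+j₁))*} → HWV_{(μ♯(n+j))*}`).  Unlike the two
  orbit closures, the ambient needs no "eventually": this is the classical inner stability of plethysm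
  (Weintraub 1990, Brion 1993, Manivel 1998; BIP 2019 Lemma 5.3).
* `plethysm_rayStable` — `a(j)` is eventually constant `=: a∞(μ)`, the maximum over the ray (monotone +
  bounded by the Kronecker coefficient in the Manivel-stable range, IP17 Prop. 2.8).
* `rayLimits_chain` — **the ordered chain of stable values `K∞(μ) ≤ a∞(μ) ≤ g∞(μ)`** (with file II:
  `P_n(μ) ≤ P∞(μ) ≤ K∞(μ) ≤ a∞(μ) ≤ g∞(μ)`): the complete stable picture of the `m → m + 1` axis.

[Weintraub, J. Algebra 129 (1990); Brion, Manuscripta Math. 80 (1993); Bürgisser–Ikenmeyer–Panova 2019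
Lemma 5.3, Prop. 5.6; Ikenmeyer–Panova 2017 Prop. 2.6(b), Prop. 2.8; this crux's `…RayStability`]
-/

set_option linter.dupNamespace false

namespace Summit.ValiantsHypothesis.ValiantsHypothesis.Theorems.ValuativeFlip

open Literature.NumberTheory.DiophantineGeometry
open Literature.Computability.AlgebraicComplexity
open Literature.Computability.Complexity
open Literature.Barriers.ValiantsHypothesis (degIdxMap degIdxMap_injective)

noncomputable section

/-- **The Kadish–Landsberg lift is injective**: `liftHWV m j = innerLift ∘ rename (degIdxMap segEmb)`,
a composition of BIP's inner lift (injective, `innerLift_injective`, BIP Lemma 5.3 "`κ` is injective")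
and a renaming along an injective map of coordinates. [Bürgisser–Ikenmeyer–Panova 2019 Lemma 5.3;
Ikenmeyer–Panova 2017 Prop. 2.6(b)] -/
theorem liftHWV_injective (m j : ℕ) [NeZero (m + j)] : Function.Injective (liftHWV m j) := by
  intro F G h
  rw [liftHWV, AlgHom.comp_apply, AlgHom.comp_apply] at h
  exact MvPolynomial.rename_injective _ (degIdxMap_injective _)
    (innerLift_injective (k := ℂ) (topMatIdx (m + j)) (Nat.le_add_right m j) h)

/-- **One lift of the ambient multiplicity**: `a_λ(δ[m]) ≤ a_{λ♯(m+j)}(δ[m+j])` for every `λ ⊢ m·δ`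
with at most `m²` parts and every `j` — the lift `liftHWV m j` restricts to an injective linear map
between the highest-weight spaces of weights `λ*` and `(λ♯(m+j))*` of the ambient coordinate rings
(`liftHWV_mem_highestWeightSpace`, `liftHWV_injective`), and the target is finite-dimensional
(`finiteDimensional_highestWeightSpace_coordRep`). [Bürgisser–Ikenmeyer–Panova 2019 Lemma 5.3;
Weintraub 1990; Brion 1993] -/
theorem plethysmCoeff_le_plethysmCoeff_rowLift {m δ : ℕ} [NeZero m] (lam : Nat.Partition (m * δ))
    (hlam : lam.parts.card ≤ m * m) (j : ℕ) [NeZero (m + j)] :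
    plethysmCoeff ℂ (MatIdx m) m (partitionWeightLex m lam) ≤
      plethysmCoeff ℂ (MatIdx (m + j)) (m + j) (partitionWeightLex (m + j) (rowLift lam j)) := by
  set HW := highestWeightSpace (coordRep (MatIdx m) ℂ m) (partitionWeightLex m lam) with hHW
  set HW' := highestWeightSpace (coordRep (MatIdx (m + j)) ℂ (m + j))
    (partitionWeightLex (m + j) (rowLift lam j)) with hHW'
  haveI : FiniteDimensional ℂ HW' :=
    finiteDimensional_highestWeightSpace_coordRep_holds (k := ℂ) (σ := MatIdx (m + j)) (NeZero.ne (m + j)) _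
  let Φ : HW →ₗ[ℂ] HW' :=
    LinearMap.codRestrict HW' ((liftHWV m j).toLinearMap.comp HW.subtype)
      fun F => liftHWV_mem_highestWeightSpace lam hlam j F.2
  have hΦ : Function.Injective Φ := by
    intro F G hFG
    apply Subtype.ext
    exact liftHWV_injective m j (congrArg Subtype.val hFG)
  exact LinearMap.finrank_le_finrank_of_injective hΦ

/-- Transport of `a_λ(δ[m])` along an equality of levels and of parts. [folklore] -/
theorem plethysmCoeff_congr_level {m₁ m₂ : ℕ} (h : m₁ = m₂) {D₁ D₂ : ℕ}
    (lam₁ : Nat.Partition D₁) (lam₂ : Nat.Partition D₂) (hp : lam₁.parts = lam₂.parts) :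
    plethysmCoeff ℂ (MatIdx m₁) m₁ (partitionWeightLex m₁ lam₁) =
      plethysmCoeff ℂ (MatIdx m₂) m₂ (partitionWeightLex m₂ lam₂) := by
  subst h
  have hD : D₁ = D₂ := by rw [← lam₁.parts_sum, ← lam₂.parts_sum, hp]
  subst hD
  obtain rfl : lam₁ = lam₂ := Nat.Partition.ext hp
  rfl

/-- **INNER PLETHYSM MONOTONICITY ALONG THE RAY, AT EVERY STEP**: for `μ ⊢ n·δ` with at most `n²`
parts and all `j₁ ≤ j`, `a_{μ♯(n+j₁)}(δ[n+j₁]) ≤ a_{μ♯(n+j)}(δ[n+j])` — no "eventually" is needed for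
the ambient, in contrast with the two orbit closures (`det_ray_eventually_ge`, k4's
`eventualPaddingTransfer`). [Weintraub 1990; Brion 1993; Bürgisser–Ikenmeyer–Panova 2019 Lemma 5.3] -/
theorem plethysm_ray_mono (n δ : ℕ) [NeZero n] (μ : Nat.Partition (n * δ)) (hμ : μ.parts.card ≤ n * n)
    {j₁ j : ℕ} (hj : j₁ ≤ j) :
    plethysmCoeff ℂ (MatIdx (n + j₁)) (n + j₁) (partitionWeightLex (n + j₁) (rowLift μ j₁)) ≤
      plethysmCoeff ℂ (MatIdx (n + j)) (n + j) (partitionWeightLex (n + j) (rowLift μ j)) := by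
  obtain ⟨j', rfl⟩ : ∃ j', j = j₁ + j' := ⟨j - j₁, by omega⟩
  haveI : NeZero (n + j₁) := ⟨by have := NeZero.ne n; omega⟩
  haveI : NeZero (n + j₁ + j') := ⟨by have := NeZero.ne n; omega⟩
  have h := plethysmCoeff_le_plethysmCoeff_rowLift (rowLift μ j₁) (card_parts_rowLift_le_sq μ hμ j₁) j'
  rwa [plethysmCoeff_congr_level (show n + j₁ + j' = n + (j₁ + j') by ring)
    (rowLift (rowLift μ j₁) j') (rowLift μ (j₁ + j')) (parts_rowLift_rowLift μ j₁ j')] at h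

/-- **The ambient ray is bounded** beyond the body threshold: for `j ≥ J = |μ̄|`,
`a_{μ♯(n+j)}(δ[n+j]) ≤ g(μ♯(n+j), (n+j)×δ, (n+j)×δ) ≤ g(μ♯(n+J), (n+J)×δ, (n+J)×δ)` (IP17 Prop. 2.8 in
the Manivel-stable range `|μ̄| ≤ n + j`, then `kroneckerCoeff_rowLift_le`).
[Ikenmeyer–Panova 2017 Thm. 2.1, Prop. 2.8; Manivel 2011 Thm. 1] -/
theorem plethysm_ray_bdd (n δ : ℕ) [NeZero n] (μ : Nat.Partition (n * δ)) (hμ : μ.parts.card ≤ n * n) :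
    ∃ B J : ℕ, ∀ j : ℕ, J ≤ j →
      plethysmCoeff ℂ (MatIdx (n + j)) (n + j) (partitionWeightLex (n + j) (rowLift μ j)) ≤ B := by
  set J := bodySize μ with hJ
  haveI : NeZero (n + J) := ⟨by have := NeZero.ne n; omega⟩
  have hbody : bodySize (rowLift μ J) ≤ n + J := by rw [bodySize_rowLift]; omega
  refine ⟨kroneckerCoeff ℂ (rowLift μ J) (Nat.Partition.rectangle (n + J) δ) (Nat.Partition.rectangle (n + J) δ),
    J, fun j hj => ?_⟩
  obtain ⟨j', rfl⟩ : ∃ j', j = J + j' := ⟨j - J, by omega⟩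
  haveI : NeZero (n + J + j') := ⟨by have := NeZero.ne n; omega⟩
  have hbody' : bodySize (rowLift (rowLift μ J) j') ≤ n + J + j' := by
    rw [bodySize_rowLift, bodySize_rowLift]; omega
  have h := (ikenmeyerPanova2017_prop_2_8_holds (n + J + j') δ (rowLift (rowLift μ J) j')
    (card_parts_rowLift_le_sq (rowLift μ J) (card_parts_rowLift_le_sq μ hμ J) j') hbody').trans
    (kroneckerCoeff_rowLift_le (rowLift μ J) hbody j')
  rwa [plethysmCoeff_congr_level (show n + J + j' = n + (J + j') by ring)
    (rowLift (rowLift μ J) j') (rowLift μ (J + j')) (parts_rowLift_rowLift μ J j')] at h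

/-- **RAY STABILITY OF THE AMBIENT PLETHYSM COEFFICIENT.**  For `n ≥ 1`, `δ`, `μ ⊢ n·δ` with at most
`n²` parts, `a(j) = a_{μ♯(n+j)}(δ[n+j])` is non-decreasing in `j` and eventually CONSTANT `=: a∞(μ)`,
with `a(j) ≤ a∞(μ)` for every `j` (monotone, `plethysm_ray_mono`, and bounded, `plethysm_ray_bdd`).
The sharp threshold (`j ≥ μ₂ - n` and `μ₂ + |μ̄| ≤ (n+j)δ`) is BIP Prop. 5.6(2), discharged in the tree
(`bip2019_prop_5_6_2_holds`); only eventual constancy is recorded here.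
[Weintraub 1990; Brion 1993; Bürgisser–Ikenmeyer–Panova 2019 Prop. 5.6] -/
theorem plethysm_rayStable (n δ : ℕ) [NeZero n] (μ : Nat.Partition (n * δ)) (hμ : μ.parts.card ≤ n * n) :
    ∃ j₀ A : ℕ,
      (∀ j : ℕ, j₀ ≤ j →
        plethysmCoeff ℂ (MatIdx (n + j)) (n + j) (partitionWeightLex (n + j) (rowLift μ j)) = A) ∧
      (∀ j : ℕ, plethysmCoeff ℂ (MatIdx (n + j)) (n + j) (partitionWeightLex (n + j) (rowLift μ j)) ≤ A) :=
  nat_eventuallyConst_of_eventually_le_of_bdd _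
    (fun j₁ => ⟨j₁, fun _ hj => plethysm_ray_mono n δ μ hμ hj⟩) (plethysm_ray_bdd n δ μ hμ)

/-- **THE CHAIN OF STABLE VALUES `K∞(μ) ≤ a∞(μ) ≤ g∞(μ)`.**  For any eventual values `K∞` of the
determinant's ray (`det_rayStable`), `a∞` of the ambient ray (`plethysm_rayStable`) and `g∞` of the
Kronecker ray (`kronecker_rayStable`): `K∞ ≤ a∞` (BLMW's plethysm bound
`orbitMultiplicity_le_plethysmCoeff` at a common large level) and `a∞ ≤ g∞` (IP17 Prop. 2.8 at a
common large level in the Manivel-stable range).  With file II (under k4's eventual padding transfer)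
the full picture reads `P_n(μ) ≤ P∞(μ) ≤ K∞(μ) ≤ a∞(μ) ≤ g∞(μ)`.
[BLMW 2011 §4.4, Prop. 5.2.1; Ikenmeyer–Panova 2017 Prop. 2.8; this crux, k16] -/
theorem rayLimits_chain (n δ : ℕ) [NeZero n] (μ : Nat.Partition (n * δ)) (hμ : μ.parts.card ≤ n * n)
    {K A G : ℕ}
    (hK : ∃ j₀ : ℕ, ∀ j : ℕ, j₀ ≤ j →
      orbitMultiplicity ℂ (detFormLex ℂ (n + j)) (n + j) (partitionWeightLex (n + j) (rowLift μ j)) = K)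
    (hA : ∃ j₀ : ℕ, ∀ j : ℕ, j₀ ≤ j →
      plethysmCoeff ℂ (MatIdx (n + j)) (n + j) (partitionWeightLex (n + j) (rowLift μ j)) = A)
    (hG : ∃ j₀ : ℕ, ∀ j : ℕ, j₀ ≤ j →
      kroneckerCoeff ℂ (rowLift μ j) (Nat.Partition.rectangle (n + j) δ) (Nat.Partition.rectangle (n + j) δ) = G) :
    K ≤ A ∧ A ≤ G := by
  obtain ⟨j₀, hj₀⟩ := hK
  obtain ⟨j₁, hj₁⟩ := hA
  obtain ⟨j₂, hj₂⟩ := hG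
  set j := max (max j₀ j₁) (max j₂ (bodySize μ)) with hj
  have h0 : j₀ ≤ j := (le_max_left _ _).trans (le_max_left _ _)
  have h1 : j₁ ≤ j := (le_max_right _ _).trans (le_max_left _ _)
  have h2 : j₂ ≤ j := (le_max_left _ _).trans (le_max_right _ _)
  have hb : bodySize μ ≤ j := (le_max_right _ _).trans (le_max_right _ _)
  haveI : NeZero (n + j) := ⟨by have := NeZero.ne n; omega⟩
  refine ⟨?_, ?_⟩
  · rw [← hj₀ j h0, ← hj₁ j h1]
    exact orbitMultiplicity_le_plethysmCoeff_holds (detFormLex ℂ (n + j)) (NeZero.ne (n + j))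
      (detFormLex_isHomogeneous ℂ (n + j)) _
  · rw [← hj₁ j h1, ← hj₂ j h2]
    have hbody : bodySize (rowLift μ j) ≤ n + j := by rw [bodySize_rowLift]; omega
    exact ikenmeyerPanova2017_prop_2_8_holds (n + j) δ (rowLift μ j) (card_parts_rowLift_le_sq μ hμ j) hbody

end

end Summit.ValiantsHypothesis.ValiantsHypothesis.Theorems.ValuativeFlip
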